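import Literature.Probability.Percolation.SlabCriticality
import Literature.Probability.Percolation.SlabGluingFact2Boxes
import HarnessLib

/-!
# DST 2016, Lemma 6 (the Gluing Lemma) discharged in its full range: the graft over `S_{3n}`,
# the clipped cleared box, Fact 2 over `U'`, and `DuminilCopinSidoraviciusTassion2016_lemma6_holds`

Topic: `Literature/Probability/Percolation`. A proofs file for `SlabCriticality.lean` (sibling of
`SlabCriticalityProofs.lean`, which discharges the waypoints eq. (1), (12), (13) and the finite-size
criterion): the named fact
`DuminilCopinSidoraviciusTassion2016_lemma6` (Duminil-Copin–Sidoravicius–Tassion 2016, Lemma 6, the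
Gluing Lemma: "for any `ε > 0` there exists `δ = δ(ε, k) > 0` such that for any `n`,
`P[S_{3n} ⟷^{B_{3n}} Z_n, S'_n ⟷^{B'_n} Y_n^-, S'_n ⟷^{B'_n} Y_n^+] ≥ 1 - δ` implies
`P[S_{3n} ⟷^{B_{3n} ∪ B'_n} S'_n] ≥ 1 - ε`", stated uniformly over the geometric data of §2.1:
`n ≥ 2`, `u_{3n} ≤ n`, `u_n ≤ n/3`, `1 ≤ α_n ≤ n - 1`, `0 ≤ y ≤ 3n`) is DISCHARGED here
(`DuminilCopinSidoraviciusTassion2016_lemma6_holds`).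

The tree already proves the Gluing Lemma in the range `u_{3n} + 1 ≤ n`
(`DuminilCopinSidoraviciusTassion2016_lemma6'_holds`, `SlabGluingFact2.lean`, which suffices for
Thm. 1, `DuminilCopinSidoraviciusTassion2016_holds`): Fact 1 (`SlabGluingFact1.lean`), and Fact 2 by
the rerouting surgery `ω ↦ ω^{(z)}` in a cleared box `D(z)` around a point `z ∈ U(ω)`
(`SlabGluingFact2Core.lean`, `SlabGluingRouting.lean`). The boundary case `u_{3n} = n` — allowed by
eq. (1) of the paper (`u_n ≤ n/3`) and by the statement of Lemma 6 — is the one in which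
`S̄_{3n} = B̄_n` meets `B̄'_n` (in the column `x = n`); there a cleared box around a point of `U(ω)`
may meet `S̄_{3n}`, and rerouting `γ_min` through it could create a source vertex with a smaller key
than the start of `γ_min(ω)` (the printed proof, pp. 6–7 of arXiv:1401.7130, does not discuss balls
`B_R(z)` meeting `S_{3n}`; `GlueGeom.exists_surgery` of `SlabGluingRouting.lean` excludes the case).
This file closes the gap with two devices, both instances of DST's local-modification-plus-Lemma-7
scheme, and re-runs the bookkeeping of Fact 2 and of Lemma 6:

* `GlueGeom.Graft`, `GlueGeom.exists_graft` — **the graft** at a point `z ∈ U'(ω)` over `S_{3n}`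
  (then `z = (n, z₂)` with `u_{3n} = n`): the (P2)-witness path starts over a lattice neighbour of
  `z` inside `B'_n` which is not over `S_{3n}` (it is joined to `S̄'_n` and `ω ∉ C`), hence over
  `q = z + (1, 0)`. The grafted configuration `ω^z` (`Graft.newConfig`) closes every edge touching the
  column over `q` and opens the connector from the LAST vertex `g` of `γ_min(ω)` over `z` to the
  vertex `b₀` over `q` at the same height, the vertical branch over `q` from `b₀` to the last vertex
  `w'` of the witness path over `q`, and the first edge of the witness path out of `w'`. DST's order
  condition "`(z,v) ≺ (z,w)`" holds automatically (`Graft.vKey_d_lt`: the successor of `g` on `γ_min`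
  is a lattice neighbour of `g` at the same height, off the columns of `z` and `q`, so it lies to the
  left of `q` and has a smaller key than `b₀`); no vertex of the structure lies over `S_{3n}`. PROVED:
  `γ_min(ω^z) = γ_min(ω)` (`Graft.γmin_newConfig`, by the exchange lemma `minPath_eq_of_surgery` of
  `SlabGluingSurgery.lean`), `g ∈ Att(ω^z) ⊆ {g}` (`Graft.g_mem_att`, `Graft.att_subset`, by the
  propagation lemma of `SlabGluingRecovery.lean`), `ω^z ∈ C` (`Graft.newConfig_mem_evC`), locality
  (`Graft.mem_newConfig_iff_of_not_touch`).
* `GlueGeom.cDbox`, `GlueGeom.exists_surgOut_cDbox` — **the clipped cleared box** `D^c(z) ⊆ D(z)`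
  for the points of `U'(ω)` off `S_{3n}`: the left column of the box is kept to the right of
  `x = u_{3n}` whenever its rows can meet those of `S_{3n}` (there it is box A of
  `SlabGluingFact2Boxes.lean`; far above `S_{3n}` it is the full box `D(z)`), so that `D^c(z)` never
  meets `S_{3n}` (`cDbox_not_src`) and the rectangle case `GlueGeom.exists_surgery_rect` of
  `SlabGluingFact2Boxes.lean` (DST's rerouting with the tree's routing `exists_route`) applies in
  the full range `u_{3n} ≤ n`, at the price of a third bounded excluded set `srcCorner` (`8` points
  near the corner `(n, u_{3n})`).
* `GlueGeom.Graft.surgOut`, `GlueGeom.exists_surgOut_of_goodU'`, `fact2_U'` — both local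
  modifications are recoverable located surgeries in the sense of `GlueGeom.SurgOut`
  (`SlabGluingFact2Reduction.lean`: in `C`; attachment statistic non-empty and over `z + B_3`;
  agreement with `ω` off the pairs touching `\overline{z + B_3}`; edges old or in the window), whence
  **Fact 2 over `U'` for `t ≥ 210` in the full range** by the Lemma 7 bookkeeping
  `GlueGeom.real_le_of_surgOut` of that file (good points `goodU' = U' ∖ (zBad ∪ lastBad ∪ srcCorner)`,
  at least `(|U'| - 105)/169 ≥ t/338` selected `7`-separated points).
* `DuminilCopinSidoraviciusTassion2016_lemma6_holds` — PROVED: Lemma 6 from `fact1_U'`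
  (`SlabGluingFact1.lean`) and `fact2_U'`, by the bookkeeping of
  `DuminilCopinSidoraviciusTassion2016_lemma6_of_facts` ("choosing first `t` as in Fact 2 and then `δ`
  as in Fact 1", p. 7), with `p = 1` treated by `edgeSet_mem_evC`.

## Sources

* H. Duminil-Copin, V. Sidoravicius, V. Tassion, *Absence of infinite cluster for critical
  Bernoulli percolation on slabs*, Comm. Pure Appl. Math. 69 (2016), no. 7, 1397–1411,
  arXiv:1401.7130: Lemma 6 (p. 5 of the arXiv text); §2.3: Lemma 7, the order on paths, `γ_min`,
  `U(ω)` (P1)–(P2), the event `𝒳`, Facts 1–2 and their proofs (pp. 6–7), the conclusion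
  "Fix `ε > 0`. Choosing first `t` as in Fact 2 and then `δ` as in Fact 1 conclude the proof" (p. 7).
* C. M. Newman, V. Tassion, W. Wu, *Critical percolation and the minimal spanning tree in slabs*,
  Comm. Pure Appl. Math. 70 (2017), 2084–2120, §3.2 (vertex-lexicographic order, proof of Thm. 3.9)
  [NewmanTassionWu2017] — through the files imported.

## Design choices

* The graft keeps `γ_min(ω)` itself (nothing is rerouted), so the exchange lemma in its
  "attach a branch" form applies with the branch protected and the second vertex of the witness
  path as the only unprotected structure vertex; the graft is used only over `S_{3n}`, where the
  witness column is forced to be the right-hand neighbour, which is what makes the order condition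
  automatic for the height-lexicographic key `vKey`.
* Fact 2 is run over `U'` (lattice-neighbour witnesses, `SlabGluingFact1.lean`), for which Fact 1 is
  `fact1_U'`; the decomposition of `𝒳` along `|U'| < t` / `|U'| ≥ t` replaces that along `|U|`.
* Constants are not optimised (`t ≥ 210`, `K = 338 λ^{169(5k+4)}`); only their existence enters
  Lemma 6.
* Nothing here changes the statements of `SlabCriticality.lean`; the weaker waypoint
  `DuminilCopinSidoraviciusTassion2016_lemma6'` of `SlabCriticalityChain4.lean` follows from the fact
  discharged here by `DuminilCopinSidoraviciusTassion2016_lemma6'_of_lemma6`.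
-/

noncomputable section

namespace Literature.Probability.Percolation

open _root_.MeasureTheory LatticeModels SimpleGraph Filter

/-! ## The graft: attaching a vertical branch to `γ_min` over the right-hand neighbour column -/

section GraftData

variable (k : ℕ)

/-- **The data of a graft** at a point `z` of `U'(ω)` whose (P2)-witness starts over the
right-hand neighbour column `q = z + (1, 0)`: the last vertex `g` of `γ = γ_min(ω)` over `z`
(`γ = pre ++ g :: post`, `post ≠ []` off the column of `z`), and the `S'`-side `ω`-open path
`w' :: sgt` of (P2) from its last vertex `w'` over `q` to `S̄'_n`, inside `B̄'_n`, off the columns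
of `γ`, with `sgt` off the column `q`. [cite: DuminilCopinSidoraviciusTassion2016, §2.3, proof of Fact 2 (the local modification at a point of U(ω))] -/
structure GlueGeom.Graft (G : GlueGeom) (ω : BondConfig (slab 3 k)) where
  /-- the point of `U'(ω)` -/
  z : ℤ × ℤ
  /-- `γ_min(ω)` before its last visit to the column of `z` -/
  pre : List (slab 3 k)
  /-- the last vertex of `γ_min(ω)` over `z` -/
  g : slab 3 k
  /-- `γ_min(ω)` after `g` -/
  post : List (slab 3 k)
  /-- the last vertex over `q` of the witness path of (P2) -/
  w' : slab 3 k
  /-- the witness path after `w'` -/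
  sgt : List (slab 3 k)
  hqsmall : (z.1 + 1, z.2) ∈ G.small
  hqsrc : (z.1 + 1, z.2) ∉ G.src
  hqγ : (z.1 + 1, z.2) ∉ G.γcols k ω
  hγ : G.γmin k ω = pre ++ g :: post
  hgz : planar k g = z
  hpost : post ≠ []
  hpostz : ∀ x ∈ post, planar k x ≠ z
  hw'q : planar k w' = (z.1 + 1, z.2)
  hσchain : (w' :: sgt).IsChain (fun a b => s(a, b) ∈ ω ∧ a ≠ b)
  hσsmall : ∀ x ∈ w' :: sgt, planar k x ∈ G.small
  hσγ : ∀ x ∈ w' :: sgt, planar k x ∉ G.γcols k ω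
  hsgtq : ∀ x ∈ sgt, planar k x ≠ (z.1 + 1, z.2)
  hσsrc' : (w' :: sgt).getLast (List.cons_ne_nil _ _) ∈ slabLift k G.src'

namespace GlueGeom.Graft

variable {k} {G : GlueGeom} {ω : BondConfig (slab 3 k)} (gr : G.Graft k ω)

/-- The witness column `q = z + (1, 0)`. [folklore] -/
def q : ℤ × ℤ := (gr.z.1 + 1, gr.z.2)

/-- The foot of the branch: the vertex over `q` at the height of `g`. [folklore] -/
def b₀ : slab 3 k := vtx k gr.q (ht gr.g)

/-- The branch: the vertical segment over `q` from the height of `g` to `w'`. [folklore] -/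
def Br : List (slab 3 k) := vline k gr.q (ht gr.g) (ht gr.w')

/-- The new edges: the connector `{g, b₀}` and the edges of the branch. [folklore] -/
def E : Set (Sym2 (slab 3 k)) := {s(gr.g, gr.b₀)} ∪ edgesOf gr.Br

/-- The stub: the first edge of the witness path out of `w'` (if any). [folklore] -/
def St : Set (Sym2 (slab 3 k)) := {e | ∃ w₂ ∈ gr.sgt.head?, e = s(gr.w', w₂)}

/-- **The grafted configuration**: close every edge touching the column over `q`, then open the
connector, the branch and the stub. [cite: DuminilCopinSidoraviciusTassion2016, §2.3, proof of Fact 2] -/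
def newConfig : BondConfig (slab 3 k) := (ω \ touch k {gr.q}) ∪ gr.E ∪ gr.St

/-- The successor of `g` on `γ_min(ω)`. [folklore] -/
def d : slab 3 k := gr.post.head gr.hpost

/-! ### Elementary facts -/

/-- `w'` lies over `q`. [folklore] -/
theorem planar_w' : planar k gr.w' = gr.q := gr.hw'q

/-- `b₀` lies over `q`. [folklore] -/
theorem planar_b₀ : planar k gr.b₀ = gr.q := planar_vtx _ _

/-- `b₀` has the height of `g`. [folklore] -/
theorem ht_b₀ : ht gr.b₀ = ht gr.g := ht_vtx (ht_le _) _

/-- `w'` in coordinates. [folklore] -/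
theorem w'_eq_vtx : gr.w' = vtx k gr.q (ht gr.w') := by
  rw [← gr.planar_w']; exact (vtx_planar_ht _).symm

/-- `g` in coordinates. [folklore] -/
theorem g_eq_vtx : gr.g = vtx k gr.z (ht gr.g) := by
  rw [← gr.hgz]; exact (vtx_planar_ht _).symm

/-- The branch is a self-avoiding lattice path from `b₀` to `w'`. [folklore] -/
theorem Br_spath : SPath gr.Br gr.b₀ gr.w' := by
  have h := vline_spath (k := k) gr.q (ht_le gr.g) (ht_le gr.w')
  rw [← gr.w'_eq_vtx] at h
  exact h

/-- Membership in the branch: the vertices over `q` at heights between those of `g` and `w'`.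
[folklore] -/
theorem mem_Br_iff (v : slab 3 k) : v ∈ gr.Br ↔ planar k v = gr.q ∧
    min (ht gr.g) (ht gr.w') ≤ ht v ∧ ht v ≤ max (ht gr.g) (ht gr.w') :=
  mem_vline_iff (ht_le _) (ht_le _) v

/-- Branch vertices lie over `q`. [folklore] -/
theorem planar_of_mem_Br {v : slab 3 k} (hv : v ∈ gr.Br) : planar k v = gr.q :=
  ((gr.mem_Br_iff v).1 hv).1

/-- `b₀ ∈ Br`. [folklore] -/
theorem b₀_mem_Br : gr.b₀ ∈ gr.Br := gr.Br_spath.head_mem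

/-- `w' ∈ Br`. [folklore] -/
theorem w'_mem_Br : gr.w' ∈ gr.Br := gr.Br_spath.last_mem

/-- `q ≠ z`. [folklore] -/
theorem q_ne_z : gr.q ≠ gr.z := by
  intro h; have := congrArg Prod.fst h; simp [q] at this

/-- `g ≠ b₀` (different columns). [folklore] -/
theorem g_ne_b₀ : gr.g ≠ gr.b₀ := by
  intro h
  have := congrArg (planar k) h
  rw [gr.hgz, gr.planar_b₀] at this
  exact gr.q_ne_z this.symm

/-- `g ∈ γ_min(ω)`. [folklore] -/
theorem g_mem_γ : gr.g ∈ G.γmin k ω := by rw [gr.hγ]; simp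

/-- No vertex of `γ_min(ω)` lies over `q`. [folklore] -/
theorem not_mem_γ_of_planar {v : slab 3 k} (hv : planar k v = gr.q) : v ∉ G.γmin k ω :=
  fun h => gr.hqγ ⟨v, h, hv⟩

/-- The branch is off `γ_min(ω)`. [folklore] -/
theorem Br_not_γ {v : slab 3 k} (hv : v ∈ gr.Br) : v ∉ G.γmin k ω :=
  gr.not_mem_γ_of_planar (gr.planar_of_mem_Br hv)

/-- `b₀ ∉ γ_min(ω)`. [folklore] -/
theorem b₀_not_γ : gr.b₀ ∉ G.γmin k ω := gr.not_mem_γ_of_planar gr.planar_b₀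

/-- `w' ∉ γ_min(ω)`. [folklore] -/
theorem w'_not_γ : gr.w' ∉ G.γmin k ω := gr.not_mem_γ_of_planar gr.planar_w'

/-- The witness path is off `γ_min(ω)` (it is off its columns). [folklore] -/
theorem σ_not_γ {v : slab 3 k} (hv : v ∈ gr.w' :: gr.sgt) : v ∉ G.γmin k ω :=
  fun h => gr.hσγ v hv ⟨v, h, rfl⟩

/-- `sgt` is off the branch (it is off the column `q`). [folklore] -/
theorem sgt_not_Br {v : slab 3 k} (hv : v ∈ gr.sgt) : v ∉ gr.Br :=
  fun h => gr.hsgtq v hv (gr.planar_of_mem_Br h)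

/-- Vertices of `γ_min(ω)` are off the column `q`. [folklore] -/
theorem planar_γ_ne_q {v : slab 3 k} (hv : v ∈ G.γmin k ω) : planar k v ≠ gr.q :=
  fun h => gr.not_mem_γ_of_planar h hv

/-- `γ = pre ++ g :: d :: post.tail`. [folklore] -/
theorem γ_eq : G.γmin k ω = gr.pre ++ gr.g :: gr.d :: gr.post.tail := by
  rw [gr.hγ]; congr; exact (List.cons_head_tail gr.hpost).symm

/-- `d ∈ post`. [folklore] -/
theorem d_mem_post : gr.d ∈ gr.post := List.head_mem _

/-- `d ∈ γ_min(ω)`. [folklore] -/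
theorem d_mem_γ : gr.d ∈ G.γmin k ω := by rw [gr.hγ]; simp [gr.d_mem_post]

/-- `d` is off the column of `z` (`g` is the last visit). [folklore] -/
theorem planar_d_ne_z : planar k gr.d ≠ gr.z := gr.hpostz _ gr.d_mem_post

/-! ### The edge sets -/

/-- The new edges touch the column over `q`. [folklore] -/
theorem E_touch : gr.E ⊆ touch k {gr.q} := by
  rintro e (he | he)
  · rw [Set.mem_singleton_iff] at he; subst he
    exact mk_mem_touch_iff.2 (Or.inr gr.planar_b₀)
  · induction e using Sym2.ind with
    | h a b => exact mk_mem_touch_iff.2 (Or.inl (gr.planar_of_mem_Br (mem_of_mem_edgesOf he).1))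

/-- The stub touches the column over `q`. [folklore] -/
theorem St_touch : gr.St ⊆ touch k {gr.q} := by
  rintro e ⟨w₂, -, rfl⟩
  exact mk_mem_touch_iff.2 (Or.inl gr.planar_w')

/-- The stub is `ω`-open. [folklore] -/
theorem St_subset : gr.St ⊆ ω := by
  rintro e ⟨w₂, hw₂, rfl⟩
  have hch := gr.hσchain
  rw [List.isChain_cons] at hch
  exact (hch.1 w₂ hw₂).1

/-- **Locality**: off the pairs touching the column over `q`, the grafted configuration is the old
one. [folklore] -/
theorem mem_newConfig_iff_of_not_touch {e : Sym2 (slab 3 k)} (he : e ∉ touch k {gr.q}) :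
    e ∈ gr.newConfig ↔ e ∈ ω := by
  constructor
  · rintro ((h | h) | h)
    · exact h.1
    · exact absurd (gr.E_touch h) he
    · exact absurd (gr.St_touch h) he
  · exact fun h => Or.inl (Or.inl ⟨h, he⟩)

/-- An `ω`-open pair with both endpoints off the column `q` stays open. [folklore] -/
theorem mem_newConfig_of_off {a b : slab 3 k} (hab : s(a, b) ∈ ω) (ha : planar k a ≠ gr.q)
    (hb : planar k b ≠ gr.q) : s(a, b) ∈ gr.newConfig :=
  (gr.mem_newConfig_iff_of_not_touch (by simp [ha, hb])).2 hab

/-- A new-open pair with both endpoints off the column `q` is `ω`-open. [folklore] -/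
theorem mem_of_mem_newConfig_of_off {a b : slab 3 k} (hab : s(a, b) ∈ gr.newConfig)
    (ha : planar k a ≠ gr.q) (hb : planar k b ≠ gr.q) : s(a, b) ∈ ω :=
  (gr.mem_newConfig_iff_of_not_touch (by simp [ha, hb])).1 hab

/-- `ω^z ⊆ ω ∪ E`. [folklore] -/
theorem newConfig_subset : gr.newConfig ⊆ ω ∪ gr.E := by
  rintro e ((h | h) | h)
  · exact Or.inl h.1
  · exact Or.inr h
  · exact Or.inl (gr.St_subset h)

/-- The new edges are new-open. [folklore] -/
theorem E_subset_newConfig : gr.E ⊆ gr.newConfig := fun _ h => Or.inl (Or.inr h)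

/-- The stub is new-open. [folklore] -/
theorem St_subset_newConfig : gr.St ⊆ gr.newConfig := fun _ h => Or.inr h

/-- The connector `{g, b₀}` is new-open. [folklore] -/
theorem connector_mem : s(gr.g, gr.b₀) ∈ gr.newConfig := gr.E_subset_newConfig (Or.inl rfl)

/-- The connector is a lattice edge. [folklore] -/
theorem adj_g_b₀ : (slabGraph 3 k).Adj gr.g gr.b₀ := by
  rw [gr.g_eq_vtx]
  simp only [b₀]
  refine vtx_adj_vtx_planar ?_ _
  left; left
  simp only [q]
  ext <;> simp

/-- The new edges are lattice edges. [folklore] -/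
theorem E_lattice : gr.E ⊆ (slabGraph 3 k).edgeSet := by
  rintro e (he | he)
  · rw [Set.mem_singleton_iff] at he; subst he
    exact (SimpleGraph.mem_edgeSet _).2 gr.adj_g_b₀
  · exact edgesOf_subset_edgeSet gr.Br_spath.chain he

/-- The grafted configuration is a lattice configuration. [folklore] -/
theorem newConfig_lattice (hω : ω ⊆ (slabGraph 3 k).edgeSet) :
    gr.newConfig ⊆ (slabGraph 3 k).edgeSet := by
  intro e he
  rcases gr.newConfig_subset he with h | h
  · exact hω h
  · exact gr.E_lattice h

/-- The endpoints of a new edge. [folklore] -/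
theorem E_cases {a b : slab 3 k} (h : s(a, b) ∈ gr.E) :
    (a = gr.g ∧ b = gr.b₀) ∨ (a = gr.b₀ ∧ b = gr.g) ∨ (a ∈ gr.Br ∧ b ∈ gr.Br) := by
  rcases h with h | h
  · rw [Set.mem_singleton_iff] at h
    rcases Sym2.eq_iff.1 h with ⟨rfl, rfl⟩ | ⟨rfl, rfl⟩
    · exact Or.inl ⟨rfl, rfl⟩
    · exact Or.inr (Or.inl ⟨rfl, rfl⟩)
  · exact Or.inr (Or.inr (mem_of_mem_edgesOf h))

/-- The endpoints of the stub. [folklore] -/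
theorem St_cases {a b : slab 3 k} (h : s(a, b) ∈ gr.St) :
    (a = gr.w' ∧ b ∈ gr.sgt.head?) ∨ (b = gr.w' ∧ a ∈ gr.sgt.head?) := by
  obtain ⟨w₂, hw₂, he⟩ := h
  rcases Sym2.eq_iff.1 he with ⟨rfl, rfl⟩ | ⟨rfl, rfl⟩
  · exact Or.inl ⟨rfl, hw₂⟩
  · exact Or.inr ⟨rfl, hw₂⟩

/-- A new-open pair with an endpoint over `q` is a new edge or the stub. [folklore] -/
theorem edge_at_q {a b : slab 3 k} (h : s(a, b) ∈ gr.newConfig) (hb : planar k b = gr.q) :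
    s(a, b) ∈ gr.E ∨ s(a, b) ∈ gr.St := by
  rcases h with ((h | h) | h)
  · exact absurd (mk_mem_touch_iff.2 (Or.inr hb)) h.2
  · exact Or.inl h
  · exact Or.inr h

/-- The head of `sgt` lies in `sgt`. [folklore] -/
theorem sgt_head_mem {w₂ : slab 3 k} (h : w₂ ∈ gr.sgt.head?) : w₂ ∈ gr.sgt := List.mem_of_mem_head? h

/-- The head of `sgt` is off the column `q`. [folklore] -/
theorem sgt_head_planar {w₂ : slab 3 k} (h : w₂ ∈ gr.sgt.head?) : planar k w₂ ≠ gr.q :=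
  gr.hsgtq _ (gr.sgt_head_mem h)

/-! ### `γ` stays open; the successor of `g` -/

/-- `γ_min(ω)` is an open self-avoiding path of the grafted configuration. [folklore] -/
theorem γ_isOSAP (hA : ω ∈ G.evA k) :
    IsOSAP k gr.newConfig (slabLift k G.big) (slabLift k G.src) (slabLift k G.zSeg) (G.γmin k ω) :=
  (G.γmin_spec k hA).1.of_edges fun _ ha _ hb hab =>
    gr.mem_newConfig_of_off hab (gr.planar_γ_ne_q ha) (gr.planar_γ_ne_q hb)

/-- The grafted configuration lies in `A`. [folklore] -/
theorem newConfig_mem_evA (hA : ω ∈ G.evA k) : gr.newConfig ∈ G.evA k :=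
  (mem_slabConn_iff_exists_isOSAP _ _ _ _).2 ⟨_, gr.γ_isOSAP hA⟩

/-- The `γ`-edge out of `g`. [folklore] -/
theorem γ_rel_g_d (hA : ω ∈ G.evA k) : s(gr.g, gr.d) ∈ ω ∧ gr.g ≠ gr.d := by
  have hch := (G.γmin_spec k hA).1.chain
  rw [gr.γ_eq, List.isChain_append] at hch
  exact (List.isChain_cons_cons.1 hch.2.1).1

/-- **The successor of `g` has the height of `g` and lies to the left of the column `q`**: it is a
lattice neighbour of `g` off the column of `z` (as `g` is the last visit) and off the column `q`
(which is off `γ`). [folklore] -/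
theorem d_props (hω : ω ⊆ (slabGraph 3 k).edgeSet) (hA : ω ∈ G.evA k) :
    ht gr.d = ht gr.g ∧ (planar k gr.d).1 ≤ gr.z.1 := by
  have hadj := (slab_adj_iff _ _).1 ((SimpleGraph.mem_edgeSet _).1 (hω (gr.γ_rel_g_d hA).1))
  rw [gr.hgz] at hadj
  rcases hadj with ⟨hh, hp⟩ | ⟨hp, -⟩
  · refine ⟨hh.symm, ?_⟩
    have hne : planar k gr.d ≠ gr.q := gr.planar_γ_ne_q gr.d_mem_γ
    simp only [q, ne_eq, Prod.ext_iff] at hne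
    rcases hp with (hp | hp) | (hp | hp) <;>
      simp only [Prod.ext_iff, Prod.fst_add, Prod.snd_add] at hp <;> omega
  · exact absurd hp.symm gr.planar_d_ne_z

/-- **DST's order condition holds automatically**: `key (successor of g) < key b₀`. [folklore] -/
theorem vKey_d_lt (hω : ω ⊆ (slabGraph 3 k).edgeSet) (hA : ω ∈ G.evA k) : vKey k gr.d < vKey k gr.b₀ := by
  obtain ⟨hh, h1⟩ := gr.d_props hω hA
  refine vKey_lt_of_fst_lt (by rw [hh, gr.ht_b₀]) ?_
  rw [gr.planar_b₀]
  simp only [q]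
  omega


/-! ### Regions and joins -/

/-- `g ∈ B̄_{3n} ∪ B̄'_n`. [folklore] -/
theorem g_Reg (hA : ω ∈ G.evA k) : gr.g ∈ slabLift k (G.big ∪ G.small) :=
  slabLift_mono k Set.subset_union_left ((G.γmin_spec k hA).1.subset _ gr.g_mem_γ)

/-- The branch lies in `B̄'_n`. [folklore] -/
theorem Br_small {v : slab 3 k} (hv : v ∈ gr.Br) : v ∈ slabLift k G.small := by
  rw [mem_slabLift_iff, gr.planar_of_mem_Br hv]; exact gr.hqsmall

/-- The branch lies in `B̄_{3n} ∪ B̄'_n`. [folklore] -/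
theorem Br_Reg {v : slab 3 k} (hv : v ∈ gr.Br) : v ∈ slabLift k (G.big ∪ G.small) :=
  slabLift_mono k Set.subset_union_right (gr.Br_small hv)

/-- The branch is off `S̄_{3n}`. [folklore] -/
theorem Br_not_src {v : slab 3 k} (hv : v ∈ gr.Br) : v ∉ slabLift k G.src := by
  rw [mem_slabLift_iff, gr.planar_of_mem_Br hv]; exact gr.hqsrc

/-- One open edge joins its endpoints inside any set containing them. [folklore] -/
theorem joined_edge {ω₁ : BondConfig (slab 3 k)} {S : Set (slab 3 k)} {a b : slab 3 k}
    (hab : s(a, b) ∈ ω₁ ∧ a ≠ b) (ha : a ∈ S) (hb : b ∈ S) : ω₁ ∈ openConnIn S a b :=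
  openConnIn_head_of_mem a [b] (List.isChain_cons_cons.2 ⟨hab, List.isChain_singleton _⟩)
    (fun v hv => by
      simp only [List.mem_cons, List.not_mem_nil, or_false] at hv
      rcases hv with rfl | rfl
      · exact ha
      · exact hb) b (by simp)

/-- Every vertex of `w' :: sgt` is `ω`-joined inside `B̄'_n` to its end (in `S̄'_n`). [folklore] -/
theorem σ_joined {x : slab 3 k} (hx : x ∈ gr.w' :: gr.sgt) :
    ω ∈ openConnIn (slabLift k G.small) x ((gr.w' :: gr.sgt).getLast (List.cons_ne_nil _ _)) := by
  have h1 : ω ∈ openConnIn (slabLift k G.small) gr.w' x :=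
    openConnIn_head_of_mem _ _ gr.hσchain gr.hσsmall x hx
  have h2 := openConnIn_of_isChain _ _ gr.hσchain gr.hσsmall
  exact SlabCriticality.openConnIn_trans (openConnIn_reverse h1) h2

/-- A vertex of `w' :: sgt` is not `ω`-joined to `S̄_{3n}` inside `B̄_{3n} ∪ B̄'_n` (else `C`).
[folklore] -/
theorem σ_not_joined (hX : ω ∈ G.evX k) {x : slab 3 k} (hx : x ∈ gr.w' :: gr.sgt) {a : slab 3 k}
    (ha : a ∈ slabLift k G.src) (h : ω ∈ openConnIn (slabLift k (G.big ∪ G.small)) a x) : False :=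
  hX.2 ⟨a, ha, _, gr.hσsrc', SlabCriticality.openConnIn_trans h
    (openConnIn_mono (slabLift_mono k Set.subset_union_right) _ _ (gr.σ_joined hx))⟩

/-- A vertex of `γ` is not `ω`-adjacent to a vertex of `w' :: sgt` (else `C`). [folklore] -/
theorem not_rel_γ_σ (hX : ω ∈ G.evX k) {c a : slab 3 k} (hc : c ∈ G.γmin k ω)
    (ha : a ∈ gr.w' :: gr.sgt) (h : s(c, a) ∈ ω ∧ c ≠ a) : False := by
  have hA := GlueGeom.evA_of_evX hX
  have hγO := (G.γmin_spec k hA).1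
  refine gr.σ_not_joined hX ha (hγO.head_mem hγO.ne_nil) (SlabCriticality.openConnIn_trans
    (openConnIn_mono (slabLift_mono k Set.subset_union_left) _ _ (hγO.openConnIn_of_mem hc)) ?_)
  exact joined_edge h (slabLift_mono k Set.subset_union_left (hγO.subset c hc))
    (slabLift_mono k Set.subset_union_right (gr.hσsmall a ha))

/-- An old-open edge from a vertex of `γ` into the head of `sgt` is impossible. [folklore] -/
theorem not_edge_γ_sgt_head (hX : ω ∈ G.evX k) {c a : slab 3 k} (hc : c ∈ G.γmin k ω)
    (ha : a ∈ gr.sgt.head?) (h : s(c, a) ∈ gr.newConfig) : False := by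
  have ha' : a ∈ gr.w' :: gr.sgt := List.mem_cons_of_mem _ (gr.sgt_head_mem ha)
  have hω : s(c, a) ∈ ω :=
    gr.mem_of_mem_newConfig_of_off h (gr.planar_γ_ne_q hc) (gr.sgt_head_planar ha)
  refine gr.not_rel_γ_σ hX hc ha' ⟨hω, ?_⟩
  rintro rfl
  exact gr.σ_not_γ ha' hc

/-! ### The minimal path is unchanged -/

/-- **`γ_min(ω^z) = γ_min(ω)`**, by the exchange lemma `minPath_eq_of_surgery` with the branch
protected and the head of `sgt` as the only unprotected structure vertex; DST's order condition
is `vKey_d_lt`. [cite: DuminilCopinSidoraviciusTassion2016, §2.3, proof of Fact 2 (p. 7)] -/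
theorem γmin_newConfig (hω : ω ⊆ (slabGraph 3 k).edgeSet) (hX : ω ∈ G.evX k) :
    G.γmin k gr.newConfig = G.γmin k ω := by
  have hA := GlueGeom.evA_of_evX hX
  have hS := G.big_finite k
  have hex : ∃ l, IsOSAP k ω (slabLift k G.big) (slabLift k G.src) (slabLift k G.zSeg) l :=
    (mem_slabConn_iff_exists_isOSAP ω _ _ _).1 hA
  have hγeq : minPath k ω (slabLift k G.big) (slabLift k G.src) (slabLift k G.zSeg) = G.γmin k ω := rfl
  have hγO := (G.γmin_spec k hA).1
  set Sw : Set (slab 3 k) := {x | x ∈ gr.Br ∨ x ∈ gr.sgt.head?} with hSw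
  set Wv : Set (slab 3 k) := {x | x ∈ gr.Br} with hWv
  have hBrSw : ∀ {x}, x ∈ gr.Br → x ∈ Sw := fun hx => Or.inl hx
  refine minPath_eq_of_surgery hS hex gr.E Wv Sw (gr.γ_isOSAP hA) gr.newConfig_subset
    (fun x hx => Or.inl hx) ?_ ?_ ?_ ?_ ?_
  · -- h8: the new edges
    intro a b hab
    rw [hγeq]
    rcases gr.E_cases hab with ⟨rfl, rfl⟩ | ⟨rfl, rfl⟩ | ⟨ha, hb⟩
    · exact ⟨Or.inl gr.g_mem_γ, Or.inr (hBrSw gr.b₀_mem_Br), fun h => gr.b₀_not_γ h.2,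
        fun _ => gr.b₀_mem_Br, fun h => absurd h gr.b₀_not_γ⟩
    · exact ⟨Or.inr (hBrSw gr.b₀_mem_Br), Or.inl gr.g_mem_γ, fun h => gr.b₀_not_γ h.1,
        fun h => absurd h gr.b₀_not_γ, fun _ => gr.b₀_mem_Br⟩
    · exact ⟨Or.inr (hBrSw ha), Or.inr (hBrSw hb), fun h => gr.Br_not_γ ha h.1,
        fun h => absurd h (gr.Br_not_γ ha), fun h => absurd h (gr.Br_not_γ hb)⟩
  · -- h2: edges into the branch
    intro a b hab hb
    rw [hγeq]
    rcases gr.edge_at_q hab (gr.planar_of_mem_Br hb) with h | h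
    · rcases gr.E_cases h with ⟨rfl, -⟩ | ⟨rfl, -⟩ | ⟨ha, -⟩
      · exact Or.inl gr.g_mem_γ
      · exact Or.inr (hBrSw gr.b₀_mem_Br)
      · exact Or.inr (hBrSw ha)
    · rcases gr.St_cases h with ⟨rfl, -⟩ | ⟨-, ha⟩
      · exact Or.inr (hBrSw gr.w'_mem_Br)
      · exact Or.inr (Or.inr ha)
  · -- h4: the unprotected structure vertex is not joined to `S̄_{3n}`
    intro x hx hxW _ x₁ hx₁ hj
    have hx' : x ∈ gr.sgt.head? := hx.resolve_left hxW
    exact gr.σ_not_joined hX (List.mem_cons_of_mem _ (gr.sgt_head_mem hx'))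
      hx₁ (openConnIn_mono (slabLift_mono k Set.subset_union_left) _ _ hj)
  · -- h5: no protected vertex over `S_{3n}`
    intro v hv hvX
    exact absurd hvX (gr.Br_not_src hv)
  · -- h6: the forward-branch condition
    intro p c d r hpc a ha haγ hca
    rw [hγeq] at hpc haγ
    have hc : c ∈ G.γmin k ω := by rw [hpc]; simp
    rcases ha with ha | ha
    · rcases gr.edge_at_q hca (gr.planar_of_mem_Br ha) with h | h
      · rcases gr.E_cases h with ⟨rfl, rfl⟩ | ⟨rfl, -⟩ | ⟨hc', -⟩
        · have hd : d = gr.d := eq_of_cons_cons_eq_append hγO.nodup gr.γ_eq hpc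
          rw [hd]; exact gr.vKey_d_lt hω hA
        · exact absurd hc gr.b₀_not_γ
        · exact absurd hc (gr.Br_not_γ hc')
      · rcases gr.St_cases h with ⟨rfl, -⟩ | ⟨-, hc'⟩
        · exact absurd hc gr.w'_not_γ
        · exact absurd hc (gr.σ_not_γ (List.mem_cons_of_mem _ (gr.sgt_head_mem hc')))
    · exact (gr.not_edge_γ_sgt_head hX hc ha hca).elim

/-! ### The attachment statistic, `C`, and the window -/

/-- **`g ∈ Att(ω^z)`**, via the branch and `sgt`. [cite: DuminilCopinSidoraviciusTassion2016, §2.3, proof of Fact 2 (p. 7)] -/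
theorem g_mem_att (hω : ω ⊆ (slabGraph 3 k).edgeSet) (hX : ω ∈ G.evX k) :
    gr.g ∈ G.att k gr.newConfig := by
  have hA := GlueGeom.evA_of_evX hX
  have hμ := gr.γmin_newConfig hω hX
  refine ⟨by rw [hμ]; exact gr.g_mem_γ, (gr.w' :: gr.sgt).getLast (List.cons_ne_nil _ _),
    gr.hσsrc', ?_⟩
  set A : Set (slab 3 k) :=
    slabLift k (G.big ∪ G.small) ∩ {v | v ∉ G.γmin k gr.newConfig ∨ v = gr.g} with hAdef
  have hBrne : gr.Br ≠ [] := gr.Br_spath.ne_nil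
  have hBrhead : gr.Br.head hBrne = gr.b₀ := by
    have h := gr.Br_spath.head
    rw [List.head?_eq_some_head hBrne, Option.some.injEq] at h
    exact h
  have hBrlast : gr.Br.getLast hBrne = gr.w' := by
    have h := gr.Br_spath.last
    rw [List.getLast?_eq_some_getLast hBrne, Option.some.injEq] at h
    exact h
  have hσch := gr.hσchain
  rw [List.isChain_cons] at hσch
  have hch : (gr.g :: (gr.Br ++ gr.sgt)).IsChain (fun a b => s(a, b) ∈ gr.newConfig ∧ a ≠ b) := by
    have h : ((gr.g :: gr.Br) ++ gr.sgt).IsChain (fun a b => s(a, b) ∈ gr.newConfig ∧ a ≠ b) := by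
      refine List.IsChain.append ?_ ?_ ?_
      · rw [List.isChain_cons]
        refine ⟨fun y hy => ?_, isChain_of_edgesOf_subset gr.Br_spath.chain
          fun e he => gr.E_subset_newConfig (Or.inr he)⟩
        rw [List.head?_eq_some_head hBrne, Option.mem_def, Option.some.injEq] at hy
        rw [← hy, hBrhead]
        exact ⟨gr.connector_mem, gr.g_ne_b₀⟩
      · exact hσch.2.imp_of_mem_imp fun a b ha hb h =>
          ⟨gr.mem_newConfig_of_off h.1 (gr.hsgtq a ha) (gr.hsgtq b hb), h.2⟩
      · intro x hx y hy
        have hx' : x = gr.w' := by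
          rw [List.getLast?_eq_some_getLast (by simp), Option.mem_def, Option.some.injEq] at hx
          rw [← hx, List.getLast_cons hBrne, hBrlast]
        subst hx'
        exact ⟨gr.St_subset_newConfig ⟨y, hy, rfl⟩, (hσch.1 y hy).2⟩
    exact h
  have hsub : ∀ x ∈ gr.g :: (gr.Br ++ gr.sgt), x ∈ A := by
    intro x hx
    rcases List.mem_cons.1 hx with rfl | hx
    · exact ⟨gr.g_Reg hA, Or.inr rfl⟩
    rcases List.mem_append.1 hx with hx | hx
    · exact ⟨gr.Br_Reg hx, Or.inl (by rw [hμ]; exact gr.Br_not_γ hx)⟩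
    · have hx' : x ∈ gr.w' :: gr.sgt := List.mem_cons_of_mem _ hx
      exact ⟨slabLift_mono k Set.subset_union_right (gr.hσsmall x hx'),
        Or.inl (by rw [hμ]; exact gr.σ_not_γ hx')⟩
  have hconn := openConnIn_of_isChain gr.g (gr.Br ++ gr.sgt) hch hsub
  have e1 : gr.Br ++ gr.sgt = gr.Br.dropLast ++ (gr.w' :: gr.sgt) := by
    conv_lhs => rw [← List.dropLast_concat_getLast hBrne]
    rw [hBrlast, List.append_assoc]; rfl
  have hlast : (gr.g :: (gr.Br ++ gr.sgt)).getLast (List.cons_ne_nil _ _) =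
      (gr.w' :: gr.sgt).getLast (List.cons_ne_nil _ _) := by
    have hne1 : gr.Br ++ gr.sgt ≠ [] := by simp [hBrne]
    rw [List.getLast_cons hne1, List.getLast_congr hne1 (by simp) e1,
      List.getLast_append_of_ne_nil _ (List.cons_ne_nil _ _)]
  rw [hlast] at hconn
  exact hconn

/-- **The statistic localises the graft**: `Att(ω^z) ⊆ {g}` — another vertex of `γ_min(ω^z) = γ`
joined to `S̄'_n` off `γ` would be so by an `ω`-open path (the structure can only be entered at
`g` or from the `S'`-side), giving `C(ω)`. [cite: DuminilCopinSidoraviciusTassion2016, §2.3, proof of Fact 2 (p. 7)] -/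
theorem att_subset (hω : ω ⊆ (slabGraph 3 k).edgeSet) (hX : ω ∈ G.evX k) :
    G.att k gr.newConfig ⊆ {gr.g} := by
  have hA := GlueGeom.evA_of_evX hX
  have hμ := gr.γmin_newConfig hω hX
  have hγO := (G.γmin_spec k hA).1
  rintro q' ⟨hq'μ, s', hs', hj⟩
  rw [Set.mem_singleton_iff]
  by_contra hne
  rw [hμ] at hq'μ
  set Sw₂ : Set (slab 3 k) := {x | x = gr.g ∨ x ∈ gr.Br ∨ x ∈ gr.sgt.head?} with hSw₂
  set Wv₂ : Set (slab 3 k) := {x | x = gr.g ∨ x ∈ gr.Br} with hWv₂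
  have hq0 : ω ∈ openConnIn (slabLift k (G.big ∪ G.small)) ((G.γmin k ω).head hγO.ne_nil) q' :=
    openConnIn_mono (slabLift_mono k Set.subset_union_left) _ _ (hγO.openConnIn_of_mem hq'μ)
  have hres := not_mem_structure_of_openConnIn (Reg := slabLift k (G.big ∪ G.small))
    (A := slabLift k (G.big ∪ G.small) ∩ {v | v ∉ G.γmin k gr.newConfig ∨ v = q'})
    (fun x hx => hx.1) gr.E Wv₂ Sw₂ {gr.g}
    (by rintro x (rfl | hx); exacts [Or.inl rfl, Or.inr (Or.inl hx)])
    ((G.γmin k ω).head hγO.ne_nil) gr.newConfig_subset ?_ ?_ ?_ ?_ hj ?_ hq0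
  · exact hX.2 ⟨_, hγO.head_mem hγO.ne_nil, s', hs', hres.2⟩
  · -- new edges join structure vertices
    intro a b hab
    rcases gr.E_cases hab with ⟨rfl, rfl⟩ | ⟨rfl, rfl⟩ | ⟨ha, hb⟩
    · exact ⟨Or.inl rfl, Or.inr (Or.inl gr.b₀_mem_Br)⟩
    · exact ⟨Or.inr (Or.inl gr.b₀_mem_Br), Or.inl rfl⟩
    · exact ⟨Or.inr (Or.inl ha), Or.inr (Or.inl hb)⟩
  · -- edges into protected vertices
    rintro t x htx (rfl | hx)
    · exact Or.inr rfl
    · left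
      rcases gr.edge_at_q htx (gr.planar_of_mem_Br hx) with h | h
      · rcases gr.E_cases h with ⟨rfl, -⟩ | ⟨rfl, -⟩ | ⟨ht', -⟩
        · exact Or.inl rfl
        · exact Or.inr (Or.inl gr.b₀_mem_Br)
        · exact Or.inr (Or.inl ht')
      · rcases gr.St_cases h with ⟨rfl, -⟩ | ⟨-, ht'⟩
        · exact Or.inr (Or.inl gr.w'_mem_Br)
        · exact Or.inr (Or.inr ht')
  · -- `A` does not contain `g`
    rintro x ⟨-, hx⟩ hxg
    rw [Set.mem_singleton_iff] at hxg
    subst hxg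
    exfalso
    rcases hx with hx | hx
    · exact hx (by rw [hμ]; exact gr.g_mem_γ)
    · exact hne hx.symm
  · -- the unprotected structure vertex is not joined to `S̄_{3n}`
    intro x hx hxW hjx
    have hx' : x ∈ gr.sgt.head? := by
      rcases hx with rfl | hx | hx
      · exact absurd (Or.inl rfl) hxW
      · exact absurd (Or.inr hx) hxW
      · exact hx
    exact gr.σ_not_joined hX (List.mem_cons_of_mem _ (gr.sgt_head_mem hx'))
      (hγO.head_mem hγO.ne_nil) hjx
  · -- `q'` is off the structure
    rintro (rfl | hq' | hq')
    · exact hne rfl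
    · exact gr.Br_not_γ hq' hq'μ
    · exact gr.σ_not_γ (List.mem_cons_of_mem _ (gr.sgt_head_mem hq')) hq'μ

/-- **The grafted configuration realises `C`.** [cite: DuminilCopinSidoraviciusTassion2016, §2.3, proof of Fact 2] -/
theorem newConfig_mem_evC (hω : ω ⊆ (slabGraph 3 k).edgeSet) (hX : ω ∈ G.evX k) :
    gr.newConfig ∈ G.evC k := by
  have hA := GlueGeom.evA_of_evX hX
  obtain ⟨-, s', hs', hj⟩ := gr.g_mem_att hω hX
  have hγO' := gr.γ_isOSAP hA
  have h1 := hγO'.openConnIn_of_mem gr.g_mem_γ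
  exact ⟨_, hγO'.head_mem hγO'.ne_nil, s', hs', SlabCriticality.openConnIn_trans
    (openConnIn_mono (slabLift_mono k Set.subset_union_left) _ _ h1)
    (openConnIn_mono (fun x hx => hx.1) _ _ hj)⟩

/-- The attachment statistic of `ω^z` is non-empty. [folklore] -/
theorem att_nonempty (hω : ω ⊆ (slabGraph 3 k).edgeSet) (hX : ω ∈ G.evX k) :
    (G.att k gr.newConfig).Nonempty := ⟨gr.g, gr.g_mem_att hω hX⟩

/-- The grafted configuration consists of old edges and of lattice edges inside the window
`\overline{B_{3n} ∪ B'_n}`. [folklore] -/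
theorem mem_window_of_mem_newConfig (hA : ω ∈ G.evA k) {e : Sym2 (slab 3 k)}
    (he : e ∈ gr.newConfig) :
    e ∈ ω ∨ (e ∈ (slabGraph 3 k).edgeSet ∧ e ∈ (slabLift k (G.big ∪ G.small)).sym2) := by
  rcases gr.newConfig_subset he with h | h
  · exact Or.inl h
  · right
    refine ⟨gr.E_lattice h, ?_⟩
    induction e using Sym2.ind with
    | h a b =>
      rcases gr.E_cases h with ⟨rfl, rfl⟩ | ⟨rfl, rfl⟩ | ⟨ha, hb⟩
      · exact Set.mk_mem_sym2_iff.2 ⟨gr.g_Reg hA, gr.Br_Reg gr.b₀_mem_Br⟩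
      · exact Set.mk_mem_sym2_iff.2 ⟨gr.Br_Reg gr.b₀_mem_Br, gr.g_Reg hA⟩
      · exact Set.mk_mem_sym2_iff.2 ⟨gr.Br_Reg ha, gr.Br_Reg hb⟩

/-- `g` lies over `z`, inside the box of radius `3` around `z`. [folklore] -/
theorem g_sqBox : planar k gr.g ∈ sqBox gr.z 3 := by
  rw [gr.hgz]; simp [sqBox]

end GlueGeom.Graft

end GraftData

/-! ## The graft exists at the points of `U'(ω)` over `S_{3n}` -/

section GraftBuild

variable {k : ℕ} {G : GlueGeom} {ω : BondConfig (slab 3 k)}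

/-- PROVED — **the graft exists at every point of `U'(ω)` over `S_{3n}` below the top row of
`S_{3n}`**: such a point `z` lies in the column `x = n = u_{3n}` where `S̄_{3n}` meets `B̄'_n`, and
the (P2)-witness, which starts over a lattice neighbour of `z` inside `B'_n` and is joined to
`S̄'_n` (hence does not start over `S_{3n}`, as `ω ∉ C`), must start over `z + (1, 0)`.
[cite: DuminilCopinSidoraviciusTassion2016, §2.3, proof of Fact 2 (the local modification at a point of U(ω))] -/
theorem GlueGeom.exists_graft (hG : G.InRange) (hX : ω ∈ G.evX k) {z : ℤ × ℤ} (hz : z ∈ G.U' k ω)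
    (hzsrc : z ∈ G.src) (hz2 : z.2 + 1 ≤ (G.u₃ : ℤ)) : ∃ gr : G.Graft k ω, gr.z = z := by
  obtain ⟨hn, hu₃, hu₁, hα, hαn, hy0, hy⟩ := hG
  have hA : ω ∈ G.evA k := hX.1.1.1
  obtain ⟨hγO, -⟩ := G.γmin_spec k hA
  set γ := G.γmin k ω with hγdef
  obtain ⟨hzs, ⟨g₀, hg₀γ, hg₀z⟩, x₀, hx₀, s', hs', hπ⟩ := hz
  -- coordinates
  have hzs' := hzs
  have hzsrc' := hzsrc
  simp only [GlueGeom.small, GlueGeom.src, sqBox, Set.mem_setOf_eq, abs_le, Prod.fst_zero,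
    Prod.snd_zero, sub_zero] at hzs' hzsrc'
  -- the witness starts over `q = z + (1, 0)`
  have hx₀S : x₀ ∈ slabLift k G.small ∩ {v | planar k v ∉ G.γcols k ω} := hπ.1
  have hx₀src : planar k x₀ ∉ G.src := fun h => hX.2 ⟨x₀, h, s', hs',
    openConnIn_mono (fun v hv => slabLift_mono k Set.subset_union_right hv.1) _ _ hπ⟩
  have hx₀q : planar k x₀ = (z.1 + 1, z.2) := by
    have h1 : planar k x₀ ∈ G.small := hx₀S.1
    simp only [GlueGeom.small, GlueGeom.src, sqBox, Set.mem_setOf_eq, abs_le, Prod.fst_zero,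
      Prod.snd_zero, sub_zero] at h1 hx₀src
    rcases hp : planar k x₀ with ⟨p1, p2⟩
    rw [hp] at hx₀ h1 hx₀src
    obtain ⟨z1, z2⟩ := z
    simp only [planarAdj, Prod.mk_add_mk, Prod.mk.injEq, add_zero] at hx₀
    simp only [Prod.mk.injEq] at *
    rcases hx₀ with (⟨h1', h2'⟩ | ⟨h1', h2'⟩) | (⟨h1', h2'⟩ | ⟨h1', h2'⟩)
    · exfalso; omega
    · exact ⟨h1', h2'⟩
    · exact absurd ⟨⟨by omega, by omega⟩, ⟨by omega, by omega⟩⟩ hx₀src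
    · exact absurd ⟨⟨by omega, by omega⟩, ⟨by omega, by omega⟩⟩ hx₀src
  -- `g`: the last vertex of `γ` over `z`
  obtain ⟨pre, g, post, hγeq, hgz, hpostz⟩ :=
    exists_last_split (p := fun x => planar k x = z) γ ⟨g₀, hg₀γ, hg₀z⟩
  have hpost : post ≠ [] := by
    rintro rfl
    have h := hγO.last_mem hγO.ne_nil
    have hl : γ.getLast hγO.ne_nil = g := by
      rw [List.getLast_congr _ (by simp) hγeq, List.getLast_append_of_ne_nil _ (by simp)]; simp
    rw [hl, mem_slabLift_iff, hgz] at h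
    simp only [GlueGeom.zSeg, sideSeg, Set.mem_setOf_eq] at h
    omega
  -- the witness path and its last vertex over `q`
  obtain ⟨π, hπO⟩ := exists_isOSAP_of_openConnIn hπ
  have hx₀π : π.head hπO.ne_nil = x₀ := by
    have := hπO.head_mem hπO.ne_nil
    rwa [Set.mem_singleton_iff] at this
  have hx₀mem : x₀ ∈ π := by rw [← hx₀π]; exact List.head_mem _
  obtain ⟨πpre, w', sgt, hπeq, hw'q, hsgtq⟩ :=
    exists_last_split (p := fun x => planar k x = (z.1 + 1, z.2)) π ⟨x₀, hx₀mem, hx₀q⟩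
  have hπch := hπO.chain
  rw [hπeq, List.isChain_append] at hπch
  have hσsub : ∀ x ∈ w' :: sgt, x ∈ π := fun x hx => by rw [hπeq]; exact List.mem_append_right _ hx
  refine ⟨⟨z, pre, g, post, w', sgt, ?_, ?_, ?_, hγeq, hgz, hpost, hpostz, hw'q, hπch.2.1,
    fun x hx => (hπO.subset x (hσsub x hx)).1, fun x hx => (hπO.subset x (hσsub x hx)).2, hsgtq, ?_⟩, rfl⟩
  · rw [← hx₀q]; exact hx₀S.1
  · simp only [GlueGeom.src, sqBox, Set.mem_setOf_eq, abs_le, Prod.fst_zero, Prod.snd_zero, sub_zero,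
      not_and]
    intro h; omega
  · rw [← hx₀q]; exact hx₀S.2
  · have := hπO.last_mem hπO.ne_nil
    rw [Set.mem_singleton_iff] at this
    have h2 : (w' :: sgt).getLast (List.cons_ne_nil _ _) = π.getLast hπO.ne_nil := by
      rw [List.getLast_congr _ (by simp) hπeq, List.getLast_append_of_ne_nil _ (List.cons_ne_nil _ _)]
    rw [h2, this]; exact hs'

end GraftBuild

/-! ## The clipped cleared box (kept off `S_{3n}`) and its located surgery in the full range -/

namespace GlueGeom

variable (G : GlueGeom)

/-- Left column of the **clipped cleared box** `D^c(z)`: the tree's `bxL z = max(z₁ - 3, n)`, except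
that when the rows of the box can meet those of `S_{3n} = B_{u_{3n}}` (`z₂ ≤ u_{3n} + 3`) it is kept
to the right of the column `x = u_{3n}` (then it is `bxL' z = max(z₁ - 3, n, u_{3n} + 1)` of
`SlabGluingFact2Boxes.lean`) — so that `D^c(z)` never meets `S_{3n}`, while points of `B'_n` far
above `S_{3n}` keep the full box. [cite: DuminilCopinSidoraviciusTassion2016, §2.3, proof of Fact 2 (the ball B_R(z))] -/
def cbxL (z : ℤ × ℤ) : ℤ :=
  if z.2 ≤ (G.u₃ : ℤ) + 3 then max (z.1 - 3) (max (G.n : ℤ) (G.u₃ + 1)) else max (z.1 - 3) G.n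

/-- The clipped cleared box `D^c(z) ⊆ D(z)`. [cite: DuminilCopinSidoraviciusTassion2016, §2.3, proof of Fact 2 (the ball B_R(z))] -/
def cDbox (z : ℤ × ℤ) : Set (ℤ × ℤ) := boxR (G.cbxL z) (G.bxR z) (G.brB z) (G.brT z)

/-- The routing rectangle of the clipped box. [folklore] -/
def cRPbox (z : ℤ × ℤ) : Set (ℤ × ℤ) := boxR (G.cbxL z) (G.bxR' z) (G.brB z) (G.brP z)

/-- The points near the corner `(n, u_{3n})` of `B'_n ∩ S_{3n}` excluded from the local
modifications of this file (a bounded set: `8` points). [folklore] -/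
def srcCorner : Set (ℤ × ℤ) :=
  {z | (G.n : ℤ) ≤ z.1 ∧ z.1 ≤ G.n + 1 ∧ (G.u₃ : ℤ) ≤ z.2 ∧ z.2 ≤ G.u₃ + 3}

variable {G}

section BoxFactsC

variable {z : ℤ × ℤ}

/-- In the low rows the clipped box is box A of `SlabGluingFact2Boxes.lean`. [folklore] -/
theorem cbxL_eq_bxL' (h : z.2 ≤ (G.u₃ : ℤ) + 3) : G.cbxL z = G.bxL' z := by
  simp only [cbxL, bxL', if_pos h]

/-- In the high rows the clipped box is the tree's box `D(z)`. [folklore] -/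
theorem cbxL_eq_bxL (h : ¬ z.2 ≤ (G.u₃ : ℤ) + 3) : G.cbxL z = G.bxL z := by
  simp only [cbxL, bxL, if_neg h]

/-- The clipped box lies in the box `D(z)`. [folklore] -/
theorem cDbox_subset_Dbox : G.cDbox z ⊆ G.Dbox z := by
  intro q hq
  simp only [cDbox, Dbox, mem_boxR_iff, cbxL, bxL] at hq ⊢
  split_ifs at hq <;> omega

/-- The clipped routing rectangle lies in the routing rectangle of `D(z)`. [folklore] -/
theorem cRPbox_subset_RPbox : G.cRPbox z ⊆ G.RPbox z := by
  intro q hq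
  simp only [cRPbox, RPbox, mem_boxR_iff, cbxL, bxL] at hq ⊢
  split_ifs at hq <;> omega

/-- **The clipped box is large**: the routing rectangle has at least three columns and four rows,
inside the box. [folklore] -/
theorem cbox_frame (hG : G.InRange) (hzb : z ∈ G.big) (hzs : z ∈ G.small) :
    G.cbxL z + 2 ≤ G.bxR' z ∧ G.bxR' z ≤ G.bxR z ∧ G.brB z + 3 ≤ G.brP z ∧ G.brP z ≤ G.brT z := by
  obtain ⟨hn, hu₃, hu₁, hα, hαn, hy0, hy⟩ := hG
  simp only [big, small, sqBox, Set.mem_setOf_eq, abs_le, Prod.fst_zero, Prod.snd_zero, sub_zero] at hzb hzs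
  simp only [cbxL, bxR, bxR', brB, brP, brT, Zfull]
  split_ifs <;> omega

/-- `D^c(z) ⊆ B_{3n} ∪ B'_n`. [folklore] -/
theorem cDbox_subset_region (hG : G.InRange) (hzb : z ∈ G.big) (hzs : z ∈ G.small) :
    G.cDbox z ⊆ G.big ∪ G.small :=
  cDbox_subset_Dbox.trans (Dbox_subset_region hG hzb hzs)

/-- `D^c(z) ⊆ z + B_3`. [folklore] -/
theorem cDbox_subset_sqBox : G.cDbox z ⊆ sqBox z 3 := cDbox_subset_Dbox.trans Dbox_subset_sqBox

/-- `z ∈ D^c(z)`. [folklore] -/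
theorem mem_cDbox_self (hG : G.InRange) (hzb : z ∈ G.big) (hzs : z ∈ G.small) (hzsrc : z ∉ G.src)
    (hzc : z ∉ G.srcCorner) : z ∈ G.cDbox z := by
  obtain ⟨hn, hu₃, hu₁, hα, hαn, hy0, hy⟩ := hG
  simp only [big, small, src, sqBox, Set.mem_setOf_eq, abs_le, Prod.fst_zero, Prod.snd_zero, sub_zero,
    not_and, not_le] at hzb hzs hzsrc
  simp only [srcCorner, Set.mem_setOf_eq, not_and, not_le] at hzc
  simp only [cDbox, mem_boxR_iff, cbxL, bxR, brB, brT]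
  split_ifs <;> omega

/-- The routing rectangle lies in `B_{3n}`. [folklore] -/
theorem cRPbox_subset_big (hG : G.InRange) (hzb : z ∈ G.big) (hzs : z ∈ G.small) : G.cRPbox z ⊆ G.big :=
  fun _ hq => RPbox_subset_big hG hzb hzs (cRPbox_subset_RPbox hq)

/-- Off the excluded strip `zBad`, the routing rectangle avoids `Z_n`. [folklore] -/
theorem cRPbox_not_zSeg (hG : G.InRange) (hzb : z ∈ G.big) (hbad : z ∉ G.zBad) {q : ℤ × ℤ}
    (hq : q ∈ G.cRPbox z) : q ∉ G.zSeg :=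
  RPbox_not_zSeg hG hzb hbad (cRPbox_subset_RPbox hq)

/-- **The clipped box never meets `S_{3n}`.** [folklore] -/
theorem cDbox_not_src {q : ℤ × ℤ} (hq : q ∈ G.cDbox z) : q ∉ G.src := by
  simp only [cDbox, mem_boxR_iff, cbxL, bxR, brB, brT] at hq
  simp only [src, sqBox, Set.mem_setOf_eq, abs_le, Prod.fst_zero, Prod.snd_zero, sub_zero, not_and]
  split_ifs at hq <;> omega

/-- A lattice neighbour of `z` inside `B_{3n}` but outside `D^c(z)` is the left neighbour. [folklore] -/
theorem nbr_eq_of_not_cDbox (hG : G.InRange) (hzb : z ∈ G.big) (hzs : z ∈ G.small) (hzsrc : z ∉ G.src)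
    (hzc : z ∉ G.srcCorner) {q : ℤ × ℤ} (hadj : planarAdj z q) (hqb : q ∈ G.big)
    (hqD : q ∉ G.cDbox z) : q = (z.1 - 1, z.2) := by
  have hzD := mem_cDbox_self hG hzb hzs hzsrc hzc
  obtain ⟨hn, hu₃, hu₁, hα, hαn, hy0, hy⟩ := hG
  simp only [big, small, sqBox, Set.mem_setOf_eq, abs_le, Prod.fst_zero, Prod.snd_zero, sub_zero] at hzb hzs hqb
  simp only [cDbox, mem_boxR_iff, bxR, brB, brT, not_and] at hqD hzD
  obtain ⟨z1, z2⟩ := z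
  obtain ⟨q1, q2⟩ := q
  simp only [planarAdj, Prod.mk_add_mk, Prod.mk.injEq, add_zero] at hadj
  simp only [Prod.mk.injEq] at *
  rcases hadj with (⟨h1, h2⟩ | ⟨h1, h2⟩) | (⟨h1, h2⟩ | ⟨h1, h2⟩)
  · exfalso
    subst h1; subst h2
    exact hqD (by omega) (by omega) (by omega) (by omega)
  · exact ⟨by omega, by omega⟩
  · exfalso
    subst h1; subst h2
    exact hqD (by omega) (by omega) (by omega) (by omega)
  · exfalso
    subst h1; subst h2
    exact hqD (by omega) (by omega) (by omega) (by omega)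

/-- **The start of the (P2)-witness lies in the clipped box**: a lattice neighbour of `z` inside
`B'_n` and off `S_{3n}` lies in `D^c(z)` (off the excluded corner). [folklore] -/
theorem mem_cDbox_of_adj (hG : G.InRange) (hzs : z ∈ G.small) (hzsrc : z ∉ G.src) (hzc : z ∉ G.srcCorner)
    {q : ℤ × ℤ} (hadj : planarAdj q z) (hqs : q ∈ G.small) (hqsrc : q ∉ G.src) : q ∈ G.cDbox z := by
  obtain ⟨hn, hu₃, hu₁, hα, hαn, hy0, hy⟩ := hG
  simp only [small, src, sqBox, Set.mem_setOf_eq, abs_le, Prod.fst_zero, Prod.snd_zero, sub_zero,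
    not_and, not_le] at hzs hqs hzsrc hqsrc
  simp only [srcCorner, Set.mem_setOf_eq, not_and, not_le] at hzc
  simp only [cDbox, mem_boxR_iff, cbxL, bxR, brB, brT]
  obtain ⟨z1, z2⟩ := z
  obtain ⟨q1, q2⟩ := q
  simp only [planarAdj, Prod.mk_add_mk, Prod.mk.injEq, add_zero] at hadj
  simp only at *
  rcases hadj with (⟨h1, h2⟩ | ⟨h1, h2⟩) | (⟨h1, h2⟩ | ⟨h1, h2⟩) <;> subst h1 <;> subst h2 <;>
    split_ifs <;> omega

/-- A point of `D^c(z)` inside `B_{3n}` and off `Z_n` lies in the routing rectangle. [folklore] -/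
theorem mem_cRPbox_of (hG : G.InRange) {q : ℤ × ℤ} (hq : q ∈ G.cDbox z) (hqb : q ∈ G.big) (hqZ : q ∉ G.zSeg) :
    q ∈ G.cRPbox z := by
  obtain ⟨hn, hu₃, hu₁, hα, hαn, hy0, hy⟩ := hG
  simp only [big, sqBox, Set.mem_setOf_eq, abs_le, Prod.fst_zero, Prod.snd_zero, sub_zero] at hqb
  simp only [zSeg, sideSeg, Set.mem_setOf_eq, not_and] at hqZ
  simp only [cDbox, mem_boxR_iff] at hq
  simp only [cRPbox, mem_boxR_iff, bxR', brP, Zfull]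
  split_ifs with hZ
  · simp only [bxR, brT, brB] at hZ hq ⊢
    refine ⟨hq.1, ?_, hq.2.2.1, by omega⟩
    rcases lt_or_eq_of_le hq.2.1 with h | h
    · omega
    · exfalso; exact hqZ (by omega) (by omega) (by omega)
  · exact ⟨hq.1, hq.2.1, hq.2.2.1, by omega⟩

/-- Off `lastBad`, the last vertex of `γ_min(ω)` is off the clipped box. [folklore] -/
theorem getLast_not_cDbox {k : ℕ} {ω : BondConfig (slab 3 k)} (hzl : z ∉ G.lastBad k ω) :
    ∀ v ∈ (G.γmin k ω).getLast?, planar k v ∉ G.cDbox z := by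
  intro v hv hvD
  exact hzl ⟨v, hv, mem_sqBox_comm (cDbox_subset_sqBox hvD)⟩

end BoxFactsC

variable {k : ℕ}

/-- PROVED — **located surgery with the clipped box at every good point of `U'(ω)` off `S_{3n}`,
in the full range `u_{3n} ≤ n`**: the rectangle case `GlueGeom.exists_surgery_rect` of
`SlabGluingFact2Boxes.lean` (DST's construction of `ω^{(z)}` with the tree's routing
`exists_route`; the key condition of `GlueGeom.Surgery` over `S_{3n}` is vacuous as `D^c(z)` never
meets `S_{3n}`) applied to `D^c(z) ⊆ z + B_3`, for `ω ∈ 𝒳` a lattice configuration and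
`z ∈ U'(ω)` off `S_{3n}`, off `lastBad`, `zBad`, `srcCorner`. [cite: DuminilCopinSidoraviciusTassion2016, §2.3, proof of Fact 2 (construction of ω^{(z)})] -/
theorem exists_surgOut_cDbox (hG : G.InRange) (hk : 0 < k)
    {ω : BondConfig (slab 3 k)} (hω : ω ⊆ (slabGraph 3 k).edgeSet) (hX : ω ∈ G.evX k)
    {z : ℤ × ℤ} (hz : z ∈ G.U' k ω) (hzsrc : z ∉ G.src) (hzl : z ∉ G.lastBad k ω) (hzb : z ∉ G.zBad)
    (hzc : z ∉ G.srcCorner) : ∃ ω', G.SurgOut k 3 ω z ω' := by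
  have hA : ω ∈ G.evA k := hX.1.1.1
  obtain ⟨hγO, -⟩ := G.γmin_spec k hA
  obtain ⟨hzs, hzγ, x₀, hx₀, s', hs', hπ⟩ := hz
  have hzbig : z ∈ G.big := by
    obtain ⟨g, hgγ, hgz⟩ := hzγ
    rw [← hgz]; exact hγO.subset g hgγ
  have hx₀S : x₀ ∈ slabLift k G.small ∩ {v | planar k v ∉ G.γcols k ω} := hπ.1
  have hx₀src : planar k x₀ ∉ G.src := fun h => hX.2 ⟨x₀, h, s', hs',
    openConnIn_mono (fun v hv => slabLift_mono k Set.subset_union_right hv.1) _ _ hπ⟩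
  obtain ⟨hf1, hf2, hf3, hf4⟩ := cbox_frame hG hzbig hzs
  obtain ⟨sg, hsg⟩ := exists_surgery_rect (G := G) hk hω hX hf1 hf2 hf3 hf4
    (cDbox_subset_region hG hzbig hzs) (fun q hq => cDbox_not_src hq) (cRPbox_subset_big hG hzbig hzs)
    (fun q hq => cRPbox_not_zSeg hG hzbig hzb hq) (fun q hq hqb hqZ => mem_cRPbox_of hG hq hqb hqZ)
    (mem_cDbox_self hG hzbig hzs hzsrc hzc) hzγ
    ⟨_, fun q h1 h2 h3 => nbr_eq_of_not_cDbox hG hzbig hzs hzsrc hzc h1 h2 h3⟩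
    (getLast_not_cDbox hzl) (mem_cDbox_of_adj hG hzs hzsrc hzc hx₀ hx₀S.1 hx₀src) hs' hπ
  exact ⟨_, sg.surgOut hX (hsg ▸ cDbox_subset_sqBox)⟩

end GlueGeom

/-! ## Located surgeries at the good points of `U'(ω)`, and Fact 2 over `U'` in the full range -/

section Located

variable {k : ℕ} {G : GlueGeom} {ω : BondConfig (slab 3 k)}

/-- PROVED — **a graft is a recoverable located surgery** (radius `3`) at its point, in the sense of
`GlueGeom.SurgOut` (`SlabGluingFact2Reduction.lean`): `ω^z ∈ C`, its edges are old or lattice edges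
of the window, it agrees with `ω` off the pairs touching `\overline{z + B_3}` (indeed off those touching
the single column over `q = z + (1,0)`), and `Att(ω^z) = {g}` lies over `z`.
[cite: DuminilCopinSidoraviciusTassion2016, §2.3, proof of Fact 2 (pp. 6–7)] -/
theorem GlueGeom.Graft.surgOut (gr : G.Graft k ω) (hω : ω ⊆ (slabGraph 3 k).edgeSet) (hX : ω ∈ G.evX k) :
    G.SurgOut k 3 ω gr.z gr.newConfig where
  mem_evC := gr.newConfig_mem_evC hω hX
  subset_window := fun e he => by
    rcases gr.mem_window_of_mem_newConfig (GlueGeom.evA_of_evX hX) he with h | ⟨h1, h2⟩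
    · exact Or.inl h
    · exact Or.inr ⟨h1, h2⟩
  agree_off := fun _ he => gr.mem_newConfig_iff_of_not_touch fun h => he (touch_mono (fun q hq => by
    rw [Set.mem_singleton_iff] at hq
    subst hq
    simp [GlueGeom.Graft.q, sqBox]) h)
  att_nonempty := gr.att_nonempty hω hX
  att_near := fun q hq => by
    have := gr.att_subset hω hX hq
    rw [Set.mem_singleton_iff] at this
    rw [this]
    exact gr.g_sqBox

variable (G) (k)

/-- The good points of `U'(ω)`: off the three excluded bounded sets. [folklore] -/
def GlueGeom.goodU' (ω : BondConfig (slab 3 k)) : Set (ℤ × ℤ) :=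
  G.U' k ω \ (G.zBad ∪ G.lastBad k ω ∪ G.srcCorner)

/-- The good points form a finite set. [folklore] -/
theorem GlueGeom.goodU'_finite (ω : BondConfig (slab 3 k)) : (G.goodU' k ω).Finite :=
  (G.U'_finite k ω).subset Set.sdiff_subset

variable {G} {k}

/-- PROVED — **a recoverable located surgery exists at every good point of `U'(ω)`**, in the full
range `u_{3n} ≤ n` of the Gluing Lemma: the graft at the points over `S_{3n}`
(`GlueGeom.exists_graft`), the rerouting surgery with the clipped box elsewhere
(`GlueGeom.exists_surgOut_cDbox`).
[cite: DuminilCopinSidoraviciusTassion2016, §2.3, proof of Fact 2 (construction of ω^{(z)})] -/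
theorem GlueGeom.exists_surgOut_of_goodU' (hG : G.InRange) (hk : 0 < k) (hω : ω ⊆ (slabGraph 3 k).edgeSet)
    (hX : ω ∈ G.evX k) {z : ℤ × ℤ} (hz : z ∈ G.goodU' k ω) : ∃ ω', G.SurgOut k 3 ω z ω' := by
  obtain ⟨hzU, hzbad⟩ := hz
  simp only [Set.mem_union, not_or] at hzbad
  obtain ⟨⟨hzb, hzl⟩, hzc⟩ := hzbad
  by_cases hzsrc : z ∈ G.src
  · have hz2 : z.2 + 1 ≤ (G.u₃ : ℤ) := by
      obtain ⟨hn, hu₃, -, -, -, -, -⟩ := hG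
      have hzs := hzU.1
      simp only [GlueGeom.small, GlueGeom.src, sqBox, Set.mem_setOf_eq, abs_le, Prod.fst_zero,
        Prod.snd_zero, sub_zero] at hzs hzsrc
      simp only [GlueGeom.srcCorner, Set.mem_setOf_eq, not_and, not_le] at hzc
      omega
    obtain ⟨gr, hgr⟩ := GlueGeom.exists_graft hG hX hzU hzsrc hz2
    exact ⟨gr.newConfig, hgr ▸ gr.surgOut hω hX⟩
  · exact GlueGeom.exists_surgOut_cDbox hG hk hω hX hzU hzsrc hzl hzb hzc

/-- The excluded corner has at most `8` points. [folklore] -/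
theorem GlueGeom.ncard_inter_srcCorner_le (G : GlueGeom) (S : Set (ℤ × ℤ)) : (S ∩ G.srcCorner).ncard ≤ 8 := by
  classical
  set F : Finset (ℤ × ℤ) := (Finset.Icc (G.n : ℤ) (G.n + 1)) ×ˢ (Finset.Icc (G.u₃ : ℤ) (G.u₃ + 3)) with hF
  have hsub : S ∩ G.srcCorner ⊆ ↑F := by
    rintro w ⟨-, hw⟩
    simp only [GlueGeom.srcCorner, Set.mem_setOf_eq] at hw
    simp only [hF, Finset.coe_product, Finset.coe_Icc, Set.mem_prod, Set.mem_Icc]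
    omega
  refine (Set.ncard_le_ncard hsub (Finset.finite_toSet F)).trans ?_
  rw [Set.ncard_coe_finset, Finset.card_product, Int.card_Icc, Int.card_Icc]
  have h1 : ((G.n : ℤ) + 1 + 1 - G.n).toNat = 2 := by omega
  have h2 : ((G.u₃ : ℤ) + 3 + 1 - G.u₃).toNat = 4 := by omega
  rw [h1, h2]

/-- On any configuration, at least `|U'(ω)| - 105` points of `U'(ω)` are good. [folklore] -/
theorem GlueGeom.ncard_U'_le_goodU' (G : GlueGeom) (ω : BondConfig (slab 3 k)) :
    (G.U' k ω).ncard ≤ (G.goodU'_finite k ω).toFinset.card + 105 := by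
  classical
  have hU := G.U'_finite k ω
  have hsplit : G.U' k ω ⊆ G.goodU' k ω ∪
      (G.U' k ω ∩ G.zBad ∪ G.U' k ω ∩ G.lastBad k ω ∪ G.U' k ω ∩ G.srcCorner) := by
    intro z hz
    by_cases h : z ∈ G.zBad ∪ G.lastBad k ω ∪ G.srcCorner
    · rcases h with (h | h) | h
      · exact Or.inr (Or.inl (Or.inl ⟨hz, h⟩))
      · exact Or.inr (Or.inl (Or.inr ⟨hz, h⟩))
      · exact Or.inr (Or.inr ⟨hz, h⟩)
    · exact Or.inl ⟨hz, h⟩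
  have h1 := G.ncard_inter_zBad_le (G.U' k ω)
  have h2 := G.ncard_inter_lastBad_le ω (G.U' k ω)
  have h3 := G.ncard_inter_srcCorner_le (G.U' k ω)
  have hfin : (G.goodU' k ω ∪
      (G.U' k ω ∩ G.zBad ∪ G.U' k ω ∩ G.lastBad k ω ∪ G.U' k ω ∩ G.srcCorner)).Finite :=
    (G.goodU'_finite k ω).union (((hU.inter_of_left _).union (hU.inter_of_left _)).union (hU.inter_of_left _))
  calc (G.U' k ω).ncard
      ≤ (G.goodU' k ω ∪ (G.U' k ω ∩ G.zBad ∪ G.U' k ω ∩ G.lastBad k ω ∪ G.U' k ω ∩ G.srcCorner)).ncard :=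
        Set.ncard_le_ncard hsplit hfin
    _ ≤ (G.goodU' k ω).ncard + (G.U' k ω ∩ G.zBad ∪ G.U' k ω ∩ G.lastBad k ω ∪ G.U' k ω ∩ G.srcCorner).ncard :=
        Set.ncard_union_le _ _
    _ ≤ (G.goodU' k ω).ncard + ((G.U' k ω ∩ G.zBad ∪ G.U' k ω ∩ G.lastBad k ω).ncard +
          (G.U' k ω ∩ G.srcCorner).ncard) := by
        gcongr; exact Set.ncard_union_le _ _
    _ ≤ (G.goodU' k ω).ncard + (((G.U' k ω ∩ G.zBad).ncard + (G.U' k ω ∩ G.lastBad k ω).ncard) +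
          (G.U' k ω ∩ G.srcCorner).ncard) := by
        gcongr; exact Set.ncard_union_le _ _
    _ ≤ (G.goodU'_finite k ω).toFinset.card + 105 := by
        rw [Set.ncard_eq_toFinset_card _ (G.goodU'_finite k ω)]; omega

end Located

/-! ## Fact 2 over `U'`, for large `t`, in the full range -/

section Fact2'

variable {k : ℕ}

/-- PROVED — **DST 2016, §2.3, Fact 2 (over `U'`, for `t` large), in the full range `u_{3n} ≤ n`
of the Gluing Lemma**: `P[𝒳 ∩ {|U'| ≥ t}] ≤ (K/t) · P[S_{3n} ⟷^{B_{3n} ∪ B'_n} S'_n]` for all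
`t ≥ 210`, `K = 338 λ^{169(5k+4)}`, `λ = 2/min{p, 1-p}`. Proof as printed (pp. 6–7): Lemma 7 for a
`7`-separated family of recoverable located surgeries (`GlueGeom.real_le_of_surgOut`,
`SlabGluingFact2Reduction.lean`) at good points `z ∈ U'(ω)` (at least `(t - 105)/169 ≥ t/338` of
them, `exists_separated_subset`, `GlueGeom.ncard_U'_le_goodU'`), the surgery at `z` being the graft
over `S_{3n}` and the rerouting surgery with the clipped box elsewhere
(`GlueGeom.exists_surgOut_of_goodU'`). [cite: DuminilCopinSidoraviciusTassion2016, §2.3 (Fact 2 and its proof, pp. 6–7)] -/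
theorem fact2_U' (k : ℕ) (hk : 0 < k) (p : unitInterval) (hp0 : 0 < (p : ℝ)) (hp1 : (p : ℝ) < 1) :
    ∀ t : ℕ, 210 ≤ t → ∀ G : GlueGeom, G.InRange →
      (bondPercolation (slabGraph 3 k) p).real (G.evX k ∩ {ω | t ≤ (G.U' k ω).ncard}) ≤
        (338 * (2 / min (p : ℝ) (1 - p)) ^ ((5 * k + 4) * 169)) / t *
          (bondPercolation (slabGraph 3 k) p).real (G.evC k) := by
  intro t ht G hG
  have ht0 : (0 : ℝ) < (t : ℝ) / 338 := by positivity
  have h := G.real_le_of_surgOut k p hp0 hp1 3 (E := G.evX k ∩ {ω | t ≤ (G.U' k ω).ncard}) ?_ ht0 ?_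
  · refine h.trans_eq ?_
    rw [show (2 * (3 + 3) + 1) ^ 2 = 169 from by norm_num]
    congr 1
    field_simp
  · intro ω ω' h
    simp only [Set.mem_inter_iff, Set.mem_setOf_eq]
    rw [G.mem_evX_congr k h, G.U'_congr k h]
  · rintro ω hω ⟨hX, htU⟩
    obtain ⟨Sel, hSel, hsep, hcard⟩ := exists_separated_subset 6 (G.goodU'_finite k ω).toFinset
    refine ⟨Sel, ?_, hsep, fun z hz =>
      G.exists_surgOut_of_goodU' hG hk hω hX ((Set.Finite.mem_toFinset _).1 (hSel hz))⟩
    have hU := G.ncard_U'_le_goodU' ω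
    have hc' : (((G.goodU'_finite k ω).toFinset.card : ℕ) : ℝ) ≤ 169 * Sel.card := by
      have : (G.goodU'_finite k ω).toFinset.card ≤ 169 * Sel.card := by simpa using hcard
      exact_mod_cast this
    have hU' : ((G.U' k ω).ncard : ℝ) ≤ (G.goodU'_finite k ω).toFinset.card + 105 := by exact_mod_cast hU
    have htU' : (t : ℝ) ≤ (G.U' k ω).ncard := by exact_mod_cast htU
    have ht' : (210 : ℝ) ≤ t := by exact_mod_cast ht
    rw [div_le_iff₀ (by norm_num : (0 : ℝ) < 338)]
    linarith

end Fact2'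

/-! ## The Gluing Lemma in the full range -/

section Final

open GlueGeom

variable (k : ℕ)

/-- The event `𝒳` splits along `|U'| < t` / `|U'| ≥ t`. [folklore] -/
theorem real_evX_le_U' (G : GlueGeom) (p : unitInterval) (t : ℕ) :
    (bondPercolation (slabGraph 3 k) p).real (G.evX k) ≤
      (bondPercolation (slabGraph 3 k) p).real (G.evX k ∩ {ω | (G.U' k ω).ncard < t}) +
        (bondPercolation (slabGraph 3 k) p).real (G.evX k ∩ {ω | t ≤ (G.U' k ω).ncard}) := by
  have : G.evX k ⊆ (G.evX k ∩ {ω | (G.U' k ω).ncard < t}) ∪ (G.evX k ∩ {ω | t ≤ (G.U' k ω).ncard}) := by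
    intro ω hω
    by_cases h : (G.U' k ω).ncard < t
    · exact Or.inl ⟨hω, h⟩
    · exact Or.inr ⟨hω, not_lt.1 h⟩
  exact (measureReal_mono this).trans (measureReal_union_le _ _)

variable {k}

/-- PROVED — **Duminil-Copin–Sidoravicius–Tassion 2016, Lemma 6 (the Gluing Lemma)**, the named fact
`DuminilCopinSidoraviciusTassion2016_lemma6` of `SlabCriticality.lean` DISCHARGED in its full range
(`2 ≤ n`, `u_{3n} ≤ n`, `u_n ≤ n/3`, `1 ≤ α_n ≤ n - 1`, `0 ≤ y ≤ 3n`): "for any `ε > 0` there exists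
`δ = δ(ε, k) > 0` such that for any `n`,
`P[S_{3n} ⟷^{B_{3n}} Z_n, S'_n ⟷^{B'_n} Y_n^-, S'_n ⟷^{B'_n} Y_n^+] ≥ 1 - δ` implies
`P[S_{3n} ⟷^{B_{3n} ∪ B'_n} S'_n] ≥ 1 - ε`". Proof as printed (§2.3): Fact 1 over `U'` (`fact1_U'`,
`SlabGluingFact1.lean`), Fact 2 over `U'` for `t` large (`fact2_U'`: in the range `u_{3n} + 1 ≤ n`
this is the rerouting surgery of `SlabGluingRouting.lean`; the boundary case `u_{3n} = n`, where
`S̄_{3n}` meets `B̄'_n` and on which the printed proof is silent, is covered by the graft over the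
column `x = n` and the clipped cleared box elsewhere), and the bookkeeping "choosing first `t` as in
Fact 2 and then `δ` as in Fact 1" (p. 7): `t ≥ 210` with `K/t ≤ ε/2`, `δ(1 + λ^{(5k+4)t}) ≤ ε/2`;
the degenerate parameter `p = 1` by `edgeSet_mem_evC`.
[cite: DuminilCopinSidoraviciusTassion2016, Lemma 6; §2.3 (proof, pp. 6–7)] -/
theorem DuminilCopinSidoraviciusTassion2016_lemma6_holds : DuminilCopinSidoraviciusTassion2016_lemma6 := by
  intro k hk p hθ ε hε
  have hp0 : 0 < (p : ℝ) := coe_pos_of_theta_slab_pos hθ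
  -- the events of the statement are those of `GlueGeom`
  have key : ∀ (δ : ℝ), 0 < δ → (∀ G : GlueGeom, G.InRange →
      1 - δ ≤ (bondPercolation (slabGraph 3 k) p).real (G.evA k ∩ G.evBm k ∩ G.evBp k) →
      1 - ε ≤ (bondPercolation (slabGraph 3 k) p).real (G.evC k)) →
      ∃ δ : ℝ, 0 < δ ∧ ∀ (n u₃ u₁ α : ℕ) (y : ℤ), 2 ≤ n → u₃ ≤ n → 3 * u₁ ≤ n → 1 ≤ α → α + 1 ≤ n →
        0 ≤ y → y ≤ 3 * n →
        1 - δ ≤ (bondPercolation (slabGraph 3 k) p).real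
          (slabConn k (sqBox 0 (3 * n)) (sqBox 0 u₃) (sideSeg (3 * n) (y - α) (y + α)) ∩
            slabConn k (sqBox (2 * (n : ℤ), y) n) (sqBox (2 * (n : ℤ), y) u₁)
              (sideSeg (3 * n) (y - n) (y - α)) ∩
            slabConn k (sqBox (2 * (n : ℤ), y) n) (sqBox (2 * (n : ℤ), y) u₁)
              (sideSeg (3 * n) (y + α) (y + n))) →
        1 - ε ≤ (bondPercolation (slabGraph 3 k) p).real
          (slabConn k (sqBox 0 (3 * n) ∪ sqBox (2 * (n : ℤ), y) n) (sqBox 0 u₃)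
            (sqBox (2 * (n : ℤ), y) u₁)) := by
    intro δ hδ H
    refine ⟨δ, hδ, fun n u₃ u₁ α y h1 h2 h3 h4 h5 h6 h7 hP => ?_⟩
    exact H ⟨n, u₃, u₁, α, y⟩ ⟨h1, h2, h3, h4, h5, h6, h7⟩ hP
  rcases lt_or_ge (p : ℝ) 1 with hp1 | hp1
  · -- the main case `0 < p < 1`
    set lam : ℝ := 2 / min (p : ℝ) (1 - p) with hlam
    obtain ⟨s, hs⟩ : ∃ s : ℕ, s = (5 * k + 4) * 169 := ⟨_, rfl⟩
    obtain ⟨K, hKdef⟩ : ∃ K : ℝ, K = 338 * lam ^ s := ⟨_, rfl⟩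
    have hK := fact2_U' k hk p hp0 hp1
    have hlam1 : 1 ≤ lam := by
      rw [hlam, le_div_iff₀ (lt_min hp0 (by linarith))]
      have := min_le_left (p : ℝ) (1 - p)
      have hp1' : (p : ℝ) ≤ 1 := p.2.2
      linarith
    -- choose `t ≥ 210` with `K / t ≤ ε / 2`
    obtain ⟨t, ht1, htK⟩ : ∃ t : ℕ, 210 ≤ t ∧ K / t ≤ ε / 2 := by
      obtain ⟨t, ht⟩ := exists_nat_gt (max 210 (2 * K / ε))
      have ht0 : (0 : ℝ) < t := lt_of_lt_of_le (by norm_num) ((le_max_left _ _).trans ht.le)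
      refine ⟨t, by exact_mod_cast (le_max_left (210 : ℝ) _).trans ht.le, ?_⟩
      rw [div_le_iff₀ ht0]
      have := (le_max_right (210 : ℝ) (2 * K / ε)).trans ht.le
      rw [div_le_iff₀ hε] at this
      linarith
    obtain ⟨L, hL⟩ : ∃ L : ℝ, L = lam ^ ((5 * k + 4) * t) := ⟨_, rfl⟩
    have hL1 : 1 ≤ L := hL ▸ one_le_pow₀ hlam1
    refine key (ε / (2 * (1 + L))) (by positivity) fun G hG hP => ?_
    set P := bondPercolation (slabGraph 3 k) p with hPdef
    have hF1 := fact1_U' k p hp0 hp1 G hG t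
    have hF2 := hK t ht1 G hG
    rw [← hs, ← hlam, ← hKdef] at hF2
    rw [← hlam, ← hL] at hF1
    have hX := real_evX_le_U' k G p t
    have hT := real_triple_le k G p
    have hB : P.real (G.evBm k ∩ G.evBp k)ᶜ ≤ ε / (2 * (1 + L)) := by
      rw [measureReal_compl (measurableSet_evBm_inter_evBp k G), probReal_univ]
      have : P.real (G.evA k ∩ G.evBm k ∩ G.evBp k) ≤ P.real (G.evBm k ∩ G.evBp k) :=
        measureReal_mono (by rw [Set.inter_assoc]; exact Set.inter_subset_right)
      linarith
    have hC1 : P.real (G.evC k) ≤ 1 := measureReal_le_one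
    have hC0 : 0 ≤ P.real (G.evC k) := measureReal_nonneg
    have hKt : K / t * P.real (G.evC k) ≤ ε / 2 * P.real (G.evC k) :=
      mul_le_mul_of_nonneg_right htK hC0
    have hLB : L * P.real (G.evBm k ∩ G.evBp k)ᶜ ≤ L * (ε / (2 * (1 + L))) :=
      mul_le_mul_of_nonneg_left hB (by positivity)
    have hsum : L * (ε / (2 * (1 + L))) + ε / (2 * (1 + L)) = ε / 2 := by
      field_simp
      ring
    have hF2' : P.real (G.evX k ∩ {ω | t ≤ (G.U' k ω).ncard}) ≤ K / t * P.real (G.evC k) := hF2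
    nlinarith
  · -- `p = 1`
    have hp : p = 1 := Subtype.ext (le_antisymm p.2.2 hp1)
    subst hp
    refine key (1 / 2) one_half_pos fun G hG _ => ?_
    rw [real_eq_one_of_edgeSet_mem k (edgeSet_mem_evC k G hG)]
    linarith

end Final

end Literature.Probability.Percolation

end
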